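import Literature.AlgebraicGeometry.Resolution.HenselsLemmaProofs
import Literature.AlgebraicGeometry.Resolution.HenselizedFunctionFieldsImmediate
import Mathlib.FieldTheory.PrimitiveElement
import Mathlib.FieldTheory.SeparableDegree
import HarnessLib

/-!
# Unramified extensions of henselian fields: Hensel-root generators and unramified base change (Kuhlmann 2010, §1.1–§1.2, §2.5)

Topic: `Literature/AlgebraicGeometry/Resolution` (valued function fields). PROVED classical
inertia theory in the ambient rendering of `HenselizedFunctionFields.lean` (one algebraically
closed valued field `(Ω, V)`, fields = subfields valued by restriction of `V`,
`IsUnramifiedOver`, `IsHenselianField`), obtained from Hensel's Lemma alone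
(`Kuhlmann2010HenselsLemma_holds`, `HenselsLemmaProofs.lean`), following F.-V. Kuhlmann,
*Elimination of ramification I: The generalized stability theorem*, Trans. AMS 362 (2010)
5697–5727 = arXiv:1003.5678, §2.5 (p. 9 of the arXiv text), where it is carried out for a
finite unramified extension `F` of `K(x)^h`:

> we can choose some `ζ ∈ F̄` such that `F̄ = K(x)‾(ζ)`. Take a monic polynomial `f` with
> coefficients in the valuation ring of `K(x)` and such that `f̄` is the minimal polynomial of
> `ζ` over `K(x)‾`. By Hensel's Lemma, `f` has a root `y ∈ F` such that `ȳ = ζ`. Since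
> `deg(f) = deg(f̄)`, we obtain … `[K(x)‾(ȳ):K(x)‾] = [K(x,y):K(x)] ≥ [K(x)^h(y):K(x)^h] ≥
> [K(x)‾(ȳ):K(x)‾]`. Hence, equality holds everywhere, showing that `F = K(x)^h(y)`.

* `IsUnramifiedOver.exists_hensel_generator` — the displayed argument over ANY henselian base:
  a finite unramified `N|F` is `F(η)` for a Hensel root `η ∈ V ∩ N` of a monic `Q ∈ (V ∩ F)[X]`
  of degree `[N : F]` with separable (irreducible) reduction.
* `isUnramifiedOver_adjoin_of_separable_reduction`, `IsUnramifiedOver.sup_right` — **unramified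
  base change**: for `F` henselian, `N|F` finite unramified and `E ⊇ F` finite, `E.N = E(η)` is
  a finite UNRAMIFIED extension of `E` (`[E.N : E] = [(E.N)v : Ev]`, `v(E.N) = vE`,
  `(E.N)v = Ev(η̄)` separable over `Ev`) — the finite form of "`K^i.L ⊆ L^i`" (§1.1: `K^i` the
  absolute inertia field). Proof: with `r = [Ev(η̄) : Ev]`, lift the minimal polynomial of `η̄`
  over `Ev` and take a Hensel root `ζ` in the henselian `E(η)` with `ζ̄ = η̄`; in the henselian
  `E(ζ)` Hensel's Lemma gives a root `η'` of `Q` with `η̄' = η̄`, and roots of `Q` are told apart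
  by their residues, so `η = η' ∈ E(ζ)` (`mem_adjoin_of_hensel_descent`); hence
  `[E(η) : E] ≤ [E(ζ) : E] ≤ r ≤ [E(η)v : Ev] ≤ [E(η) : E]/(vE(η) : vE)`.
* Primitives: `exists_root_of_isHenselianField_subfield` (Hensel's Lemma inside a henselian
  subfield of `Ω`), `exists_lift_residueSubfield` (lifting monic polynomials from `Fv` to
  `V[X]` with coefficients in `F`), `eq_of_residue_eq_of_separable` (roots of a polynomial with
  separable reduction are separated by their residues), `isIntegral_of_root_of_coeff_mem`.

Relation to the tree: the defect identity of Prop. 2.18 for finite unramified `N`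
(`Kuhlmann2010DefectUnramifiedBaseChange_holds`) is proved in
`HenselizedFunctionFieldsBaseChangeProofs.lean` through conjugation over henselian subfields
(`isDefectlessExtension_sup_of_isUnramifiedOver`: `E.N|E` is defectless); the present file gives
the sharper conclusion that `E.N|E` is unramified, together with the Hensel-root generator, by
Hensel's Lemma.

## Sources

* F.-V. Kuhlmann, Trans. AMS 362 (2010) = arXiv:1003.5678: §1.1 (henselian fields, `K^i`,
  `K^r`, Hensel's Lemma), §1.2 ("unramified"), §2.5 (p. 9, displayed above). The arguments are
  standard valuation theory ([folklore]; O. Endler, *Valuation theory* (1972)).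
-/

noncomputable section

open IsLocalRing Polynomial
open scoped IntermediateField

namespace Literature.AlgebraicGeometry.Resolution

universe u

variable {Ω : Type u} [Field Ω] (V : ValuationSubring Ω)

/-! ### Hensel's Lemma inside a henselian subfield; lifting residue polynomials -/

section Primitives

/-- **Hensel's Lemma in a henselian subfield of `(Ω, V)`**: for `M ≤ Ω` with `(M, V ∩ M)`
henselian, a monic `Q ∈ Ω[X]` with coefficients in `V ∩ M` and `a ∈ V ∩ M` with `v(Q(a)) < 1`,
`v(Q'(a)) = 1`, there is a root `b ∈ V ∩ M` of `Q` with `v(b - a) < 1`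
(`Kuhlmann2010HenselsLemma_holds`). [folklore] -/
theorem exists_root_of_isHenselianField_subfield {M : Subfield Ω}
    (hM : IsHenselianField M (V.comap (algebraMap M Ω)))
    (Q : Polynomial Ω) (hQmon : Q.Monic) (hQV : ∀ i, Q.coeff i ∈ V) (hQM : ∀ i, Q.coeff i ∈ M)
    {a : Ω} (haV : a ∈ V) (haM : a ∈ M) (h1 : V.valuation (Q.eval a) < 1)
    (h2 : V.valuation (Q.derivative.eval a) = 1) :
    ∃ b ∈ M, b ∈ V ∧ Q.eval b = 0 ∧ V.valuation (b - a) < 1 := by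
  classical
  haveI : HenselianLocalRing (V.comap (algebraMap M Ω)) := hM.henselianLocalRing
  -- the structure map `V ∩ M → Ω`
  let φ : V.comap (algebraMap M Ω) →+* Ω :=
    (algebraMap M Ω).comp (V.comap (algebraMap M Ω)).subtype
  have hφ : ∀ c : V.comap (algebraMap M Ω), φ c = ((c : M) : Ω) := fun c => rfl
  -- `Q` lifts to `(V ∩ M)[X]`
  have hlifts : Q ∈ Polynomial.lifts φ := by
    rw [lifts_iff_coeff_lifts]
    intro i
    exact ⟨⟨⟨Q.coeff i, hQM i⟩, hQV i⟩, rfl⟩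
  obtain ⟨QM, hQMmap, -, hQMmon⟩ := lifts_and_natDegree_eq_and_monic hlifts hQmon
  set a₀ : V.comap (algebraMap M Ω) := ⟨⟨a, haM⟩, haV⟩ with ha₀
  have heval : ∀ (P : Polynomial (V.comap (algebraMap M Ω))) (c : V.comap (algebraMap M Ω)),
      φ (P.eval c) = (P.map φ).eval (φ c) := fun P c => by
    rw [eval_map, eval₂_at_apply]
  have hmax : ∀ c : V.comap (algebraMap M Ω),
      c ∈ maximalIdeal (V.comap (algebraMap M Ω)) ↔ V.valuation (φ c) < 1 := fun c => by
    rw [mem_maximalIdeal_iff_comapInclusion_mem, ValuationSubring.valuation_lt_one_iff]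
    rfl
  have hunit : ∀ c : V.comap (algebraMap M Ω), IsUnit c ↔ V.valuation (φ c) = 1 := fun c => by
    rw [← isUnit_map_iff (comapInclusion (F := M) V) c, ValuationSubring.valuation_eq_one_iff]
    rfl
  have h1' : QM.eval a₀ ∈ maximalIdeal (V.comap (algebraMap M Ω)) := by
    rw [hmax, heval, hQMmap]
    exact h1
  have h2' : IsUnit (QM.derivative.eval a₀) := by
    rw [hunit, heval, ← derivative_map, hQMmap]
    exact h2
  obtain ⟨b, hb, hba⟩ := HenselianLocalRing.is_henselian QM hQMmon a₀ h1' h2'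
  refine ⟨((b : M) : Ω), (b : M).2, b.2, ?_, ?_⟩
  · have h3 := congrArg φ hb.eq_zero
    rw [heval, hQMmap, map_zero] at h3
    exact h3
  · have h3 := (hmax _).mp hba
    rw [map_sub] at h3
    exact h3

/-- **Lifting a monic polynomial over the residue field `Fv ⊆ Ωv` of a subfield `F` to a monic
polynomial over `V` of the same degree with coefficients in `F`.** [folklore] -/
theorem exists_lift_residueSubfield (F : Subfield Ω) (q : Polynomial (residueSubfield F V))
    (hq : q.Monic) :
    ∃ QV : Polynomial V, QV.Monic ∧ QV.natDegree = q.natDegree ∧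
      (∀ i, ((QV.coeff i : V) : Ω) ∈ F) ∧
      QV.map (residue V) = q.map (algebraMap (residueSubfield F V) (ResidueField V)) := by
  classical
  -- the residue map `V ∩ F → Fv`, onto
  let θ : V.comap (algebraMap F Ω) →+* residueSubfield F V :=
    (residueHom V F).codRestrict (residueSubfield F V) (residueHom_mem V F)
  have hθ : Function.Surjective θ := by
    rintro ⟨r, hr⟩
    obtain ⟨c, hc, hcr⟩ := (mem_residueSubfield_iff F V r).mp hr
    exact ⟨⟨c, hc⟩, Subtype.ext hcr⟩
  obtain ⟨QO, hQO, hdeg, hmon⟩ :=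
    lifts_and_natDegree_eq_and_monic ((mem_lifts q).mpr (map_surjective θ hθ q)) hq
  have hcomp : (residue V).comp (comapInclusion (F := F) V) =
      (algebraMap (residueSubfield F V) (ResidueField V)).comp θ :=
    RingHom.ext fun _ => rfl
  refine ⟨QO.map (comapInclusion (F := F) V), hmon.map _, by rw [hmon.natDegree_map, hdeg],
    fun i => ?_, ?_⟩
  · rw [coeff_map]
    exact (QO.coeff i : F).2
  · rw [Polynomial.map_map, hcomp, ← Polynomial.map_map, hQO]

/-- **Roots with separable reduction are told apart by their residues**: if `QV ∈ V[X]` has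
separable reduction and `a, b ∈ V` are roots of `QV` with the same residue, then `a = b`
(otherwise `(X - ā)² ∣ Q̄V`). [folklore] -/
theorem eq_of_residue_eq_of_separable (QV : Polynomial V) (hsep : (QV.map (residue V)).Separable)
    {a b : V} (ha : QV.eval a = 0) (hb : QV.eval b = 0) (hab : residue V a = residue V b) :
    a = b := by
  classical
  by_contra hne
  have hfac : (X - C a) * (QV /ₘ (X - C a)) = QV := mul_divByMonic_eq_iff_isRoot.mpr ha
  have hGb : (QV /ₘ (X - C a)).eval b = 0 := by
    have h := hb
    rw [← hfac, eval_mul, eval_sub, eval_X, eval_C] at h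
    rcases mul_eq_zero.mp h with h | h
    · exact absurd (sub_eq_zero.mp h).symm hne
    · exact h
  have hGbar : ((QV /ₘ (X - C a)).map (residue V)).IsRoot (residue V a) := by
    change ((QV /ₘ (X - C a)).map (residue V)).eval (residue V a) = 0
    rw [hab, ← residue_eval_valuationSubring V, hGb, map_zero]
  have hdvd : (X - C (residue V a)) * (X - C (residue V a)) ∣ QV.map (residue V) := by
    conv_rhs => rw [← hfac]
    rw [Polynomial.map_mul, Polynomial.map_sub, map_X, map_C]
    exact mul_dvd_mul_left _ (dvd_iff_isRoot.mpr hGbar)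
  exact not_isUnit_X_sub_C (residue V a) (hsep.squarefree _ hdvd)

/-- Residues and evaluation: `residue (QV(w)) = q̄(w̄)` when `QV` reduces to `q`. [folklore] -/
theorem residue_eval_eq_aeval_of_map_eq {F : Subfield Ω} {QV : Polynomial V}
    {q : Polynomial (residueSubfield F V)}
    (hred : QV.map (residue V) = q.map (algebraMap (residueSubfield F V) (ResidueField V)))
    (w : V) : residue V (QV.eval w) = aeval (residue V w) q := by
  rw [residue_eval_valuationSubring V, hred, eval_map, aeval_def]

/-- Same for the derivative. [folklore] -/
theorem residue_eval_derivative_eq_aeval_of_map_eq {F : Subfield Ω} {QV : Polynomial V}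
    {q : Polynomial (residueSubfield F V)}
    (hred : QV.map (residue V) = q.map (algebraMap (residueSubfield F V) (ResidueField V)))
    (w : V) : residue V (QV.derivative.eval w) = aeval (residue V w) (derivative q) := by
  rw [residue_eval_valuationSubring V, ← derivative_map, hred, derivative_map, eval_map, aeval_def]

end Primitives

/-! ### A finite unramified extension of a henselian field is generated by a Hensel root -/

section Generator

variable {V}

/-- `K(s)` is contained in a subfield `N` containing `K` and `s`. [folklore] -/
theorem adjoin_toSubfield_le_of_subset {K N : Subfield Ω} (hKN : K ≤ N) {s : Set Ω} (hs : s ⊆ N) :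
    (IntermediateField.adjoin K s).toSubfield ≤ N := by
  have h1 : IntermediateField.adjoin K s ≤ Subfield.extendScalars hKN :=
    IntermediateField.adjoin_le_iff.mpr hs
  exact fun y hy => h1 hy

variable (V)

/-- **A finite unramified extension `N` of a henselian `F` (inside `(Ω, V)`) is `F(η)` for a
root `η ∈ V ∩ N` of a monic `Q ∈ (V ∩ F)[X]` of degree `[N : F]` whose reduction is a separable
(irreducible) polynomial over `Fv`** (Kuhlmann 2010, §2.5, p. 9: "Take a monic polynomial `f`
with coefficients in the valuation ring … such that `f̄` is the minimal polynomial of `ζ` … By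
Hensel's Lemma, `f` has a root `y ∈ F` such that `ȳ = ζ`. Since `deg(f) = deg(f̄)` …"): `ζ` a
primitive element of the separable `Nv|Fv`, `Q` a lift of its minimal polynomial, `η` a Hensel
root in the henselian `N`; `[F(η) : F] ≤ deg Q = [Nv : Fv] = [N : F]` and
`[F(η) : F] ≥ [F(η)v : Fv] ≥ [Fv(ζ) : Fv] = [N : F]` force `F(η) = N`. PROVED.
[cite: Kuhlmann2010, Section 2.5 (p. 9)] -/
theorem IsUnramifiedOver.exists_hensel_generator [IsAlgClosed Ω] {F N : Subfield Ω}
    (hF : IsHenselianField F (V.comap (algebraMap F Ω))) (h : IsUnramifiedOver V F N) :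
    ∃ (η : Ω) (hηV : η ∈ V) (QV : Polynomial V) (q : Polynomial (residueSubfield F V)),
      η ∈ N ∧ QV.Monic ∧ (∀ i, ((QV.coeff i : V) : Ω) ∈ F) ∧
      QV.map (residue V) = q.map (algebraMap (residueSubfield F V) (ResidueField V)) ∧
      q.Separable ∧ QV.natDegree = Subfield.relfinrank F N ∧
      QV.eval ⟨η, hηV⟩ = 0 ∧
      (IntermediateField.adjoin F ({η} : Set Ω)).toSubfield = N := by
  classical
  obtain ⟨hFN, hpos, hdeg, hsep, -⟩ := h
  set k := residueSubfield F V with hk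
  have hkNv : k ≤ residueSubfield N V := residueSubfield_subfield_mono hFN
  -- `Nv` as a finite separable extension `Nv'` of `k = Fv`
  set Nv' : IntermediateField k (ResidueField V) := Subfield.extendScalars hkNv with hNv'
  have hfr : Subfield.relfinrank k (residueSubfield N V) = Module.finrank k Nv' :=
    Subfield.relfinrank_eq_finrank_of_le hkNv
  haveI : FiniteDimensional k Nv' := by
    have h0 : 0 < Module.finrank k Nv' := by rw [← hfr, ← hdeg]; exact hpos
    exact Module.finite_of_finrank_pos h0
  haveI : Algebra.IsSeparable k Nv' :=
    ⟨fun y => (isSeparable_map_iff Nv'.val Subtype.val_injective).mp (hsep (y : ResidueField V) y.2)⟩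
  -- a primitive element `ζ = θb` and its minimal polynomial `q`
  obtain ⟨α, hα⟩ := Field.exists_primitive_element k Nv'
  set θb : ResidueField V := (α : ResidueField V) with hθb
  have hθbNv : θb ∈ residueSubfield N V := α.2
  have hαint : IsIntegral k α := Algebra.IsIntegral.isIntegral α
  have hθint : IsIntegral k θb :=
    (isIntegral_algebraMap_iff (algebraMap Nv' (ResidueField V)).injective).mpr hαint
  set q : Polynomial k := minpoly k α with hqdef
  have hqθ : minpoly k θb = q :=
    minpoly.algebraMap_eq (algebraMap Nv' (ResidueField V)).injective α
  have hqmon : q.Monic := minpoly.monic hαint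
  have hqsep : q.Separable := Algebra.IsSeparable.isSeparable k α
  have hqaeval : aeval θb q = 0 := by rw [← hqθ]; exact minpoly.aeval k θb
  have hqdeg : q.natDegree = Subfield.relfinrank F N := by
    rw [hdeg, hfr, hqdef, ← IntermediateField.adjoin.finrank hαint, hα, IntermediateField.finrank_top']
  -- lift `q` to `QV` over `V` with coefficients in `F`
  obtain ⟨QV, hQVmon, hQVdeg, hQVF, hQVred⟩ := exists_lift_residueSubfield V F q hqmon
  set Q : Polynomial Ω := QV.map (algebraMap V Ω) with hQ
  have hQmon : Q.Monic := hQVmon.map _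
  have hQcoeffV : ∀ i, Q.coeff i ∈ V := fun i => by rw [hQ, coeff_map]; exact (QV.coeff i).2
  have hQcoeffF : ∀ i, Q.coeff i ∈ F := fun i => by rw [hQ, coeff_map]; exact hQVF i
  have hQeval : ∀ w : V, Q.eval (w : Ω) = ((QV.eval w : V) : Ω) := fun w => by
    rw [coe_eval_valuationSubring]
  -- a lift `c ∈ V ∩ N` of `θb`, and the henselian field `N`
  obtain ⟨c, hcV, hcθ⟩ := (mem_residueSubfield_iff N V θb).mp hθbNv
  have hNh : IsHenselianField N (V.comap (algebraMap N Ω)) :=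
    IsHenselianField.of_subfield_algebraic V hFN
      (fun y hy => isAlgebraic_of_relfinrank_pos hFN hpos hy) hF
  -- Hensel: a root `η ∈ V ∩ N` of `Q` with residue `θb`
  have h1 : V.valuation (Q.eval (algebraMap N Ω c)) < 1 := by
    rw [show algebraMap N Ω c = ((⟨algebraMap N Ω c, hcV⟩ : V) : Ω) from rfl, hQeval,
      ← ValuationSubring.valuation_lt_one_iff, ← residue_eq_zero_iff,
      residue_eval_eq_aeval_of_map_eq V hQVred, hcθ]
    exact hqaeval
  have h2 : V.valuation (Q.derivative.eval (algebraMap N Ω c)) = 1 := by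
    rw [show algebraMap N Ω c = ((⟨algebraMap N Ω c, hcV⟩ : V) : Ω) from rfl, hQ, derivative_map,
      ← coe_eval_valuationSubring, ← ValuationSubring.valuation_eq_one_iff,
      ← residue_ne_zero_iff_isUnit, residue_eval_derivative_eq_aeval_of_map_eq V hQVred, hcθ]
    exact hqsep.aeval_derivative_ne_zero hqaeval
  obtain ⟨η, hηN, hηV, hηQ, hηc⟩ := exists_root_of_isHenselianField_subfield V hNh Q hQmon
    hQcoeffV (fun i => hFN (hQcoeffF i)) hcV c.2 h1 h2
  have hηQV : QV.eval ⟨η, hηV⟩ = 0 := by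
    apply Subtype.val_injective
    rw [← hQeval]
    exact hηQ
  have hηres : residue V ⟨η, hηV⟩ = θb := by
    rw [← hcθ, ← sub_eq_zero, ← map_sub, residue_eq_zero_iff, ValuationSubring.valuation_lt_one_iff]
    exact hηc
  -- `F(η) ≤ N`, and the degrees
  set Fη : Subfield Ω := (IntermediateField.adjoin F ({η} : Set Ω)).toSubfield with hFη
  have hFFη : F ≤ Fη := subfield_le_toSubfield _
  have hFηN : Fη ≤ N := adjoin_toSubfield_le_of_subset hFN (Set.singleton_subset_iff.mpr hηN)
  have hηFη : η ∈ Fη := IntermediateField.subset_adjoin F ({η} : Set Ω) rfl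
  -- `Q` over `F`; `η` is integral of degree `≤ n`
  have hliftsF : Q ∈ Polynomial.lifts (algebraMap F Ω) := by
    rw [lifts_iff_coeff_lifts]
    intro i
    exact ⟨⟨Q.coeff i, hQcoeffF i⟩, rfl⟩
  obtain ⟨QF, hQFmap, hQFdeg, hQFmon⟩ := lifts_and_natDegree_eq_and_monic hliftsF hQmon
  have hηQF : aeval η QF = 0 := by rw [aeval_def, ← eval_map, hQFmap]; exact hηQ
  have hint : IsIntegral F η := ⟨QF, hQFmon, by rw [← aeval_def]; exact hηQF⟩
  have hn : Q.natDegree = Subfield.relfinrank F N := by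
    rw [hQ, hQVmon.natDegree_map, hQVdeg, hqdeg]
  have hdegFη : Subfield.relfinrank F Fη = (minpoly F η).natDegree := by
    rw [hFη, relfinrank_toSubfield_eq_finrank, IntermediateField.adjoin.finrank hint]
  have hle1 : Subfield.relfinrank F Fη ≤ Subfield.relfinrank F N := by
    rw [hdegFη, ← hn, ← hQFdeg]
    exact natDegree_le_natDegree (minpoly.degree_le_of_ne_zero F η hQFmon.ne_zero hηQF)
  have hposFη : 0 < Subfield.relfinrank F Fη := by
    rw [hFη, relfinrank_toSubfield_eq_finrank]
    haveI : FiniteDimensional F (IntermediateField.adjoin F ({η} : Set Ω)) :=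
      IntermediateField.adjoin.finiteDimensional hint
    exact Module.finrank_pos
  -- `[F(η) : F] ≥ [F(η)v : Fv] ≥ [Fv(θb) : Fv] = n`
  obtain ⟨he, hf, hef⟩ := relIndex_mul_relfinrank_le_relfinrank V hFFη hposFη
  set S : IntermediateField k (ResidueField V) := IntermediateField.adjoin k ({θb} : Set (ResidueField V))
    with hS
  have hkS : k ≤ S.toSubfield := subfield_le_toSubfield S
  have hSFη : S.toSubfield ≤ residueSubfield Fη V := by
    refine adjoin_toSubfield_le_of_subset (residueSubfield_subfield_mono hFFη)
      (Set.singleton_subset_iff.mpr ?_)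
    rw [← hηres]
    exact (mem_residueSubfield_iff Fη V _).mpr ⟨⟨η, hηFη⟩, hηV, rfl⟩
  have hSdeg : Subfield.relfinrank k S.toSubfield = Subfield.relfinrank F N := by
    rw [hS, relfinrank_toSubfield_eq_finrank, IntermediateField.adjoin.finrank hθint, hqθ, hqdeg]
  have hle2 : Subfield.relfinrank F N ≤ Subfield.relfinrank F Fη := by
    have hmul := Subfield.relfinrank_mul_relfinrank hkS hSFη
    have hpos2 : 0 < Subfield.relfinrank S.toSubfield (residueSubfield Fη V) := by
      rcases Nat.eq_zero_or_pos (Subfield.relfinrank S.toSubfield (residueSubfield Fη V)) with h0 | h0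
      · rw [h0, mul_zero] at hmul
        rw [← hmul] at hf
        exact absurd hf (lt_irrefl 0)
      · exact h0
    calc Subfield.relfinrank F N = Subfield.relfinrank k S.toSubfield * 1 := by rw [hSdeg, mul_one]
      _ ≤ Subfield.relfinrank k S.toSubfield *
            Subfield.relfinrank S.toSubfield (residueSubfield Fη V) := Nat.mul_le_mul_left _ hpos2
      _ = Subfield.relfinrank k (residueSubfield Fη V) := hmul
      _ ≤ (valueSubgroup F V).relIndex (valueSubgroup Fη V) *
            Subfield.relfinrank k (residueSubfield Fη V) := Nat.le_mul_of_pos_left _ he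
      _ ≤ Subfield.relfinrank F Fη := hef
  have heq : Subfield.relfinrank F Fη = Subfield.relfinrank F N := le_antisymm hle1 hle2
  -- hence `F(η) = N`
  have hFηN' : Fη = N := by
    have hmul := Subfield.relfinrank_mul_relfinrank hFFη hFηN
    rw [heq] at hmul
    have h1' : Subfield.relfinrank Fη N = 1 := by
      have h3 : Subfield.relfinrank F N * Subfield.relfinrank Fη N = Subfield.relfinrank F N * 1 := by
        rw [hmul, mul_one]
      exact Nat.eq_of_mul_eq_mul_left hpos h3
    exact le_antisymm hFηN (Subfield.relfinrank_eq_one_iff.mp h1')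
  refine ⟨η, hηV, QV, q, hηN, hQVmon, hQVF, hQVred, hqsep, ?_, hηQV, hFηN'⟩
  rw [hQVdeg, hqdeg]

end Generator

/-! ### Unramified base change -/

section BaseChange

variable {V}

/-- `E ⊔ F(η) = E(η)` for `F ≤ E` (as subfields of `Ω`). [folklore] -/
theorem sup_adjoin_toSubfield_eq {F E : Subfield Ω} (hFE : F ≤ E) (η : Ω) :
    E ⊔ (IntermediateField.adjoin F ({η} : Set Ω)).toSubfield =
      (IntermediateField.adjoin E ({η} : Set Ω)).toSubfield := by
  apply le_antisymm
  · refine sup_le (subfield_le_toSubfield _) ?_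
    exact adjoin_toSubfield_le_of_subset (hFE.trans (subfield_le_toSubfield _))
      (Set.singleton_subset_iff.mpr (IntermediateField.subset_adjoin E ({η} : Set Ω) rfl))
  · refine adjoin_toSubfield_le_of_subset le_sup_left (Set.singleton_subset_iff.mpr ?_)
    have h : (IntermediateField.adjoin F ({η} : Set Ω)).toSubfield ≤
        E ⊔ (IntermediateField.adjoin F ({η} : Set Ω)).toSubfield := le_sup_right
    exact h (IntermediateField.subset_adjoin F ({η} : Set Ω) rfl)

variable (V)

/-- `Q ∈ Ω[X]` with coefficients in a subfield `E` descends to `E[X]`; a root is then integral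
over `E` with minimal polynomial of degree `≤ deg Q`. [folklore] -/
theorem isIntegral_of_root_of_coeff_mem {E : Subfield Ω} (Q : Polynomial Ω) (hQmon : Q.Monic)
    (hQE : ∀ i, Q.coeff i ∈ E) {x : Ω} (hx : Q.eval x = 0) :
    IsIntegral E x ∧ (minpoly E x).natDegree ≤ Q.natDegree := by
  have hlifts : Q ∈ Polynomial.lifts (algebraMap E Ω) := by
    rw [lifts_iff_coeff_lifts]
    intro i
    exact ⟨⟨Q.coeff i, hQE i⟩, rfl⟩
  obtain ⟨QE, hQEmap, hQEdeg, hQEmon⟩ := lifts_and_natDegree_eq_and_monic hlifts hQmon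
  have hxQE : aeval x QE = 0 := by rw [aeval_def, ← eval_map, hQEmap]; exact hx
  have hint : IsIntegral E x := ⟨QE, hQEmon, by rw [← aeval_def]; exact hxQE⟩
  refine ⟨hint, ?_⟩
  rw [← hQEdeg]
  exact natDegree_le_natDegree (minpoly.degree_le_of_ne_zero E x hQEmon.ne_zero hxQE)

/-- **Henselian descent of a Hensel root.** Let `E ≤ Ω` be henselian, `QV ∈ V[X]` monic with
coefficients in `E` and separable reduction, `η ∈ V` a root of `QV`, and `μ` a monic separable
polynomial over `Ev` vanishing at `η̄`. Then `η ∈ E(ζ)` for some `ζ` integral over `E` of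
degree `≤ deg μ`: lift `μ` to `V[X]` with coefficients in `E` and take a Hensel root `ζ` in the
henselian `E(η)` with `ζ̄ = η̄`; in the henselian `E(ζ)` Hensel's Lemma gives a root `η'` of
`QV` with `η̄' = ζ̄ = η̄`, and roots of `QV` are told apart by their residues, so `η = η' ∈ E(ζ)`.
[folklore] -/
theorem mem_adjoin_of_hensel_descent [IsAlgClosed Ω] {E : Subfield Ω}
    (hEh : IsHenselianField E (V.comap (algebraMap E Ω))) {η : Ω} (hηV : η ∈ V)
    (QV : Polynomial V) (hQVmon : QV.Monic) (hQVE : ∀ i, ((QV.coeff i : V) : Ω) ∈ E)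
    (hsepV : (QV.map (residue V)).Separable) (hηQV : QV.eval ⟨η, hηV⟩ = 0)
    (μ : Polynomial (residueSubfield E V)) (hμmon : μ.Monic) (hμsep : μ.Separable)
    (hμη : aeval (residue V ⟨η, hηV⟩) μ = 0) :
    ∃ ζ : Ω, IsIntegral E ζ ∧ (minpoly E ζ).natDegree ≤ μ.natDegree ∧
      η ∈ (IntermediateField.adjoin E ({ζ} : Set Ω)).toSubfield := by
  classical
  set Q : Polynomial Ω := QV.map (algebraMap V Ω) with hQ
  have hQmon : Q.Monic := hQVmon.map _
  have hQcoeffV : ∀ i, Q.coeff i ∈ V := fun i => by rw [hQ, coeff_map]; exact (QV.coeff i).2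
  have hQcoeffE : ∀ i, Q.coeff i ∈ E := fun i => by rw [hQ, coeff_map]; exact hQVE i
  have hQeval : ∀ w : V, Q.eval (w : Ω) = ((QV.eval w : V) : Ω) := fun w => by
    rw [coe_eval_valuationSubring]
  set ηV : V := ⟨η, hηV⟩ with hηVdef
  have hηQ : Q.eval η = 0 := by
    rw [show η = ((ηV : V) : Ω) from rfl, hQeval, hηQV, ZeroMemClass.coe_zero]
  -- `L = E(η)` is a finite extension of `E`, hence henselian
  set L : Subfield Ω := (IntermediateField.adjoin E ({η} : Set Ω)).toSubfield with hL
  have hEL : E ≤ L := subfield_le_toSubfield _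
  have hηL : η ∈ L := IntermediateField.subset_adjoin E ({η} : Set Ω) rfl
  obtain ⟨hintE, -⟩ := isIntegral_of_root_of_coeff_mem (E := E) Q hQmon hQcoeffE hηQ
  have hposL : 0 < Subfield.relfinrank E L := by
    rw [hL, relfinrank_toSubfield_eq_finrank, IntermediateField.adjoin.finrank hintE]
    exact minpoly.natDegree_pos hintE
  have hLh : IsHenselianField L (V.comap (algebraMap L Ω)) :=
    IsHenselianField.of_subfield_algebraic V hEL
      (fun y hy => isAlgebraic_of_relfinrank_pos hEL hposL hy) hEh
  -- lift `μ` to `MV` over `V` with coefficients in `E`; Hensel in `L` at `η` gives `ζ`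
  obtain ⟨MV, hMVmon, hMVdeg, hMVE, hMVred⟩ := exists_lift_residueSubfield V E μ hμmon
  set Mu : Polynomial Ω := MV.map (algebraMap V Ω) with hMu
  have hMumon : Mu.Monic := hMVmon.map _
  have hMucoeffV : ∀ i, Mu.coeff i ∈ V := fun i => by rw [hMu, coeff_map]; exact (MV.coeff i).2
  have hMucoeffE : ∀ i, Mu.coeff i ∈ E := fun i => by rw [hMu, coeff_map]; exact hMVE i
  have h1 : V.valuation (Mu.eval η) < 1 := by
    rw [show η = ((ηV : V) : Ω) from rfl, hMu, ← coe_eval_valuationSubring,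
      ← ValuationSubring.valuation_lt_one_iff, ← residue_eq_zero_iff,
      residue_eval_eq_aeval_of_map_eq V hMVred]
    exact hμη
  have h2 : V.valuation (Mu.derivative.eval η) = 1 := by
    rw [show η = ((ηV : V) : Ω) from rfl, hMu, derivative_map, ← coe_eval_valuationSubring,
      ← ValuationSubring.valuation_eq_one_iff, ← residue_ne_zero_iff_isUnit,
      residue_eval_derivative_eq_aeval_of_map_eq V hMVred]
    exact hμsep.aeval_derivative_ne_zero hμη
  obtain ⟨ζ, hζL, hζV, hζMu, hζη⟩ := exists_root_of_isHenselianField_subfield V hLh Mu hMumon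
    hMucoeffV (fun i => hEL (hMucoeffE i)) hηV hηL h1 h2
  set ζV : V := ⟨ζ, hζV⟩ with hζVdef
  have hζres : residue V ζV = residue V ηV := by
    rw [← sub_eq_zero, ← map_sub, residue_eq_zero_iff, ValuationSubring.valuation_lt_one_iff]
    exact hζη
  -- `M = E(ζ)`, henselian; `[M : E] ≤ deg μ`
  obtain ⟨hintζ, hdegζ⟩ := isIntegral_of_root_of_coeff_mem (E := E) Mu hMumon hMucoeffE hζMu
  have hdegζ' : (minpoly E ζ).natDegree ≤ μ.natDegree := by
    rw [← hMVdeg, ← hMVmon.natDegree_map (algebraMap V Ω), ← hMu]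
    exact hdegζ
  set M : Subfield Ω := (IntermediateField.adjoin E ({ζ} : Set Ω)).toSubfield with hM
  have hEM : E ≤ M := subfield_le_toSubfield _
  have hζM : ζ ∈ M := IntermediateField.subset_adjoin E ({ζ} : Set Ω) rfl
  have hposM : 0 < Subfield.relfinrank E M := by
    rw [hM, relfinrank_toSubfield_eq_finrank, IntermediateField.adjoin.finrank hintζ]
    exact minpoly.natDegree_pos hintζ
  have hMh : IsHenselianField M (V.comap (algebraMap M Ω)) :=
    IsHenselianField.of_subfield_algebraic V hEM
      (fun y hy => isAlgebraic_of_relfinrank_pos hEM hposM hy) hEh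
  -- Hensel in `M` at `ζ` for `Q`: a root `η'` with `η̄' = η̄`, so `η' = η ∈ M`
  have hred : ∀ w : V, residue V (QV.eval w) = (QV.map (residue V)).eval (residue V w) :=
    fun w => residue_eval_valuationSubring V QV w
  have hηbroot : (QV.map (residue V)).eval (residue V ηV) = 0 := by
    rw [← hred, hηQV, map_zero]
  have h1' : V.valuation (Q.eval ζ) < 1 := by
    rw [show ζ = ((ζV : V) : Ω) from rfl, hQeval, ← ValuationSubring.valuation_lt_one_iff,
      ← residue_eq_zero_iff, hred, hζres]
    exact hηbroot
  have h2' : V.valuation (Q.derivative.eval ζ) = 1 := by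
    rw [show ζ = ((ζV : V) : Ω) from rfl, hQ, derivative_map, ← coe_eval_valuationSubring,
      ← ValuationSubring.valuation_eq_one_iff, ← residue_ne_zero_iff_isUnit,
      residue_eval_valuationSubring V, ← derivative_map, hζres, ← coe_aeval_eq_eval]
    exact hsepV.aeval_derivative_ne_zero (by rw [coe_aeval_eq_eval]; exact hηbroot)
  obtain ⟨η', hη'M, hη'V, hη'Q, hη'ζ⟩ := exists_root_of_isHenselianField_subfield V hMh Q hQmon
    hQcoeffV (fun i => hEM (hQcoeffE i)) hζV hζM h1' h2'
  have hη'res : residue V ⟨η', hη'V⟩ = residue V ηV := by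
    rw [← hζres, ← sub_eq_zero, ← map_sub, residue_eq_zero_iff,
      ValuationSubring.valuation_lt_one_iff]
    exact hη'ζ
  have hη'QV : QV.eval ⟨η', hη'V⟩ = 0 := by
    apply Subtype.val_injective
    rw [← hQeval, ZeroMemClass.coe_zero]
    exact hη'Q
  have hηη' : (⟨η', hη'V⟩ : V) = ηV := eq_of_residue_eq_of_separable V QV hsepV hη'QV hηQV hη'res
  refine ⟨ζ, hintζ, hdegζ', ?_⟩
  have h3 : η = η' := (congrArg Subtype.val hηη').symm
  rw [h3]
  exact hη'M

/-- **Hensel-root extensions of henselian fields are unramified**: for `E ≤ Ω` henselian and a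
root `η ∈ V` of a monic `QV ∈ V[X]` with coefficients in `E` and separable reduction, `E(η)|E`
is a finite unramified extension (degree `=` residue degree `= [Ev(η̄) : Ev]`, equal value
groups, separable residue extension `Ev(η̄)|Ev`). PROVED: with `r = [Ev(η̄) : Ev]`, henselian
descent (`mem_adjoin_of_hensel_descent` for the minimal polynomial of `η̄`) gives
`[E(η) : E] ≤ r ≤ [E(η)v : Ev] ≤ [E(η) : E] / (vE(η) : vE)`. [folklore] -/
theorem isUnramifiedOver_adjoin_of_separable_reduction [IsAlgClosed Ω] {E : Subfield Ω}
    (hEh : IsHenselianField E (V.comap (algebraMap E Ω))) {η : Ω} (hηV : η ∈ V)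
    (QV : Polynomial V) (hQVmon : QV.Monic) (hQVE : ∀ i, ((QV.coeff i : V) : Ω) ∈ E)
    (hsepV : (QV.map (residue V)).Separable) (hηQV : QV.eval ⟨η, hηV⟩ = 0) :
    IsUnramifiedOver V E (IntermediateField.adjoin E ({η} : Set Ω)).toSubfield := by
  classical
  set ηV : V := ⟨η, hηV⟩ with hηVdef
  set ηb : ResidueField V := residue V ηV with hηb
  set L : Subfield Ω := (IntermediateField.adjoin E ({η} : Set Ω)).toSubfield with hL
  have hEL : E ≤ L := subfield_le_toSubfield _
  have hηL : η ∈ L := IntermediateField.subset_adjoin E ({η} : Set Ω) rfl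
  -- `η` integral over `E`, `[L : E] = deg minpoly > 0`
  have hηQ : (QV.map (algebraMap V Ω)).eval η = 0 := by
    rw [show η = ((ηV : V) : Ω) from rfl, ← coe_eval_valuationSubring, hηQV, ZeroMemClass.coe_zero]
  obtain ⟨hintE, -⟩ := isIntegral_of_root_of_coeff_mem (E := E) (QV.map (algebraMap V Ω))
    (hQVmon.map _) (fun i => by rw [coeff_map]; exact hQVE i) hηQ
  have hdL : Subfield.relfinrank E L = (minpoly E η).natDegree := by
    rw [hL, relfinrank_toSubfield_eq_finrank, IntermediateField.adjoin.finrank hintE]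
  have hposL : 0 < Subfield.relfinrank E L := by rw [hdL]; exact minpoly.natDegree_pos hintE
  -- residue fields `Ev ≤ Lv ∋ η̄`; `η̄` separable over `Ev`
  set Ev := residueSubfield E V with hEv
  set Lv := residueSubfield L V with hLv
  have hEvLv : Ev ≤ Lv := residueSubfield_subfield_mono hEL
  have hηbLv : ηb ∈ Lv := (mem_residueSubfield_iff L V _).mpr ⟨⟨η, hηL⟩, hηV, rfl⟩
  have hηbroot : (QV.map (residue V)).eval ηb = 0 := by
    rw [hηb, ← residue_eval_valuationSubring V, hηQV, map_zero]
  have hliftsv : QV.map (residue V) ∈ Polynomial.lifts (algebraMap Ev (ResidueField V)) := by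
    rw [lifts_iff_coeff_lifts]
    intro i
    rw [coeff_map]
    exact ⟨⟨residue V (QV.coeff i), (mem_residueSubfield_iff E V _).mpr
      ⟨⟨_, hQVE i⟩, (QV.coeff i).2, rfl⟩⟩, rfl⟩
  obtain ⟨qE, hqE⟩ := (mem_lifts _).mp hliftsv
  have hsepηb : IsSeparable Ev ηb := by
    have h1 : aeval ηb qE = 0 := by rw [aeval_def, ← eval_map, hqE]; exact hηbroot
    have h2 : qE.Separable := by
      rw [← Polynomial.separable_map (algebraMap Ev (ResidueField V)), hqE]
      exact hsepV
    exact Polynomial.Separable.of_dvd h2 (minpoly.dvd Ev ηb h1)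
  have hηbint : IsIntegral Ev ηb := hsepηb.isIntegral
  -- henselian descent for `μ = minpoly_{Ev}(η̄)`: `[L : E] ≤ deg μ`
  set μ : Polynomial Ev := minpoly Ev ηb with hμ
  obtain ⟨ζ, hintζ, hdegζ, hηM⟩ := mem_adjoin_of_hensel_descent V hEh hηV QV hQVmon hQVE hsepV
    hηQV μ (minpoly.monic hηbint) hsepηb (minpoly.aeval Ev ηb)
  set M : Subfield Ω := (IntermediateField.adjoin E ({ζ} : Set Ω)).toSubfield with hM
  have hEM : E ≤ M := subfield_le_toSubfield _
  have hLM : L ≤ M := adjoin_toSubfield_le_of_subset hEM (Set.singleton_subset_iff.mpr hηM)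
  have hdM : Subfield.relfinrank E M = (minpoly E ζ).natDegree := by
    rw [hM, relfinrank_toSubfield_eq_finrank, IntermediateField.adjoin.finrank hintζ]
  have hposM : 0 < Subfield.relfinrank E M := by rw [hdM]; exact minpoly.natDegree_pos hintζ
  have hdLle : Subfield.relfinrank E L ≤ μ.natDegree := by
    have hmul := Subfield.relfinrank_mul_relfinrank hEL hLM
    have hpos2 : 0 < Subfield.relfinrank L M := by
      rcases Nat.eq_zero_or_pos (Subfield.relfinrank L M) with h0 | h0
      · rw [h0, mul_zero] at hmul
        rw [← hmul] at hposM
        exact absurd hposM (lt_irrefl 0)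
      · exact h0
    calc Subfield.relfinrank E L = Subfield.relfinrank E L * 1 := (mul_one _).symm
      _ ≤ Subfield.relfinrank E L * Subfield.relfinrank L M := Nat.mul_le_mul_left _ hpos2
      _ = Subfield.relfinrank E M := hmul
      _ ≤ μ.natDegree := hdM ▸ hdegζ
  -- `deg μ = [Ev(η̄) : Ev] ≤ [Lv : Ev]`
  obtain ⟨he, hf, hef⟩ := relIndex_mul_relfinrank_le_relfinrank V hEL hposL
  set S : IntermediateField Ev (ResidueField V) :=
    IntermediateField.adjoin Ev ({ηb} : Set (ResidueField V)) with hS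
  have hEvS : Ev ≤ S.toSubfield := subfield_le_toSubfield S
  have hSLv : S.toSubfield ≤ Lv :=
    adjoin_toSubfield_le_of_subset hEvLv (Set.singleton_subset_iff.mpr hηbLv)
  have hSdeg : Subfield.relfinrank Ev S.toSubfield = μ.natDegree := by
    rw [hS, relfinrank_toSubfield_eq_finrank, IntermediateField.adjoin.finrank hηbint]
  have hmulv := Subfield.relfinrank_mul_relfinrank hEvS hSLv
  have hpos3 : 0 < Subfield.relfinrank S.toSubfield Lv := by
    rcases Nat.eq_zero_or_pos (Subfield.relfinrank S.toSubfield Lv) with h0 | h0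
    · rw [h0, mul_zero] at hmulv
      rw [← hmulv] at hf
      exact absurd hf (lt_irrefl 0)
    · exact h0
  have hrle : μ.natDegree ≤ Subfield.relfinrank Ev Lv := by
    calc μ.natDegree = Subfield.relfinrank Ev S.toSubfield * 1 := by rw [hSdeg, mul_one]
      _ ≤ Subfield.relfinrank Ev S.toSubfield * Subfield.relfinrank S.toSubfield Lv :=
          Nat.mul_le_mul_left _ hpos3
      _ = Subfield.relfinrank Ev Lv := hmulv
  -- the squeeze `[L : E] ≤ deg μ ≤ [Lv : Ev] ≤ (vL : vE)[Lv : Ev] ≤ [L : E]`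
  have hfd : Subfield.relfinrank Ev Lv = Subfield.relfinrank E L :=
    le_antisymm ((Nat.le_mul_of_pos_left _ he).trans hef) (hdLle.trans hrle)
  have he1 : (valueSubgroup E V).relIndex (valueSubgroup L V) = 1 := by
    have h3 : (valueSubgroup E V).relIndex (valueSubgroup L V) * Subfield.relfinrank Ev Lv ≤
        1 * Subfield.relfinrank Ev Lv := by
      rw [one_mul]
      exact hef.trans hfd.symm.le
    have h4 := Nat.le_of_mul_le_mul_right h3 hf
    omega
  have hLvS : Lv = S.toSubfield := by
    have hposS : 0 < Subfield.relfinrank Ev S.toSubfield := by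
      rw [hSdeg]
      exact minpoly.natDegree_pos hηbint
    have h3 : Subfield.relfinrank Ev S.toSubfield * Subfield.relfinrank S.toSubfield Lv ≤
        Subfield.relfinrank Ev S.toSubfield * 1 := by
      rw [hmulv, mul_one, hSdeg, hfd]
      exact hdLle
    have h4 := Nat.le_of_mul_le_mul_left h3 hposS
    have h5 : Subfield.relfinrank S.toSubfield Lv = 1 := by omega
    exact le_antisymm (Subfield.relfinrank_eq_one_iff.mp h5) hSLv
  -- conclusion
  haveI : Algebra.IsSeparable Ev S :=
    (IntermediateField.isSeparable_adjoin_simple_iff_isSeparable _ _).mpr hsepηb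
  refine ⟨hEL, hposL, hfd.symm, fun r hr => ?_, ?_⟩
  · have hr' : r ∈ S.toSubfield := by
      rw [← hLvS]
      exact hr
    have h6 : IsSeparable Ev (S.val ⟨r, hr'⟩) :=
      (isSeparable_map_iff S.val S.val.toRingHom.injective).mpr
        (Algebra.IsSeparable.isSeparable Ev (⟨r, hr'⟩ : S))
    rw [IntermediateField.val_mk] at h6
    exact h6
  · exact le_antisymm (Subgroup.relIndex_eq_one.mp he1) (valueSubgroup_subfield_mono hEL)

/-- **Unramified base change** (the valuation theory behind Kuhlmann 2010, Prop. 2.18 for a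
finite unramified `N|F`, i.e. `N` inside the absolute inertia field `F^i ⊆ F^r`; classically
"`K^i.L ⊆ L^i`" for algebraic `L|K`): for `F ≤ Ω` henselian, `N|F` finite unramified and `E ⊇ F`
finite, the compositum `E.N = E ⊔ N` is a finite UNRAMIFIED extension of `E`. PROVED: with
`N = F(η)` as in `IsUnramifiedOver.exists_hensel_generator`, `E.N = E(η)` and
`isUnramifiedOver_adjoin_of_separable_reduction` applies over the henselian `E`.
[cite: Kuhlmann2010, Section 1.1 and Section 2.5 (p. 9)] -/
theorem IsUnramifiedOver.sup_right [IsAlgClosed Ω] {F N E : Subfield Ω}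
    (hF : IsHenselianField F (V.comap (algebraMap F Ω))) (hN : IsUnramifiedOver V F N)
    (hFE : F ≤ E) (hposE : 0 < Subfield.relfinrank F E) : IsUnramifiedOver V E (E ⊔ N) := by
  obtain ⟨η, hηV, QV, q, -, hQVmon, hQVF, hQVred, hqsep, -, hηQV, hNeq⟩ :=
    hN.exists_hensel_generator V hF
  have hEh : IsHenselianField E (V.comap (algebraMap E Ω)) :=
    IsHenselianField.of_subfield_algebraic V hFE
      (fun y hy => isAlgebraic_of_relfinrank_pos hFE hposE hy) hF
  have hsepV : (QV.map (residue V)).Separable := by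
    rw [hQVred]
    exact hqsep.map
  rw [← hNeq, sup_adjoin_toSubfield_eq hFE η]
  exact isUnramifiedOver_adjoin_of_separable_reduction V hEh hηV QV hQVmon
    (fun i => hFE (hQVF i)) hsepV hηQV

end BaseChange

end Literature.AlgebraicGeometry.Resolution
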